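import Summits.BirchSwinnertonDyer.BirchSwinnertonDyer.Theorems.ByReductionTypeAtTwoAdditiveKatoFineConjAAbelianTwoDivision
import Literature.NumberTheory.IwasawaTheory.ClassicalMuVanishesRealQuadraticTwo
import Literature.NumberTheory.IwasawaTheory.ClassicalMuVanishesQuadraticAscentIntrinsic
import Literature.NumberTheory.EllipticCurves.FineSelmerLimThm35AtTwoUpstairsProofs
import Literature.NumberTheory.NumberFields.CMQuadraticExtension
import Literature.NumberTheory.QuadraticFields.SquareRootGenerator
import HarnessLib

/-!
# Statement (A) at `(E, 2)` WITHOUT Ferrero–Washington when `[ℚ(E[2]) : ℚ] ≤ 2` (a rational `2`-torsion point): the honest carrier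
# `ℚ(E[2], √−1)` is `ℚ(i)` or a quadratic extension of the TOTALLY COMPLEX `ℚ(i)`, so its `μ₂ = 0` is a kernel theorem

HONEST FRAMING. Written by the attached prover seat `bsd-line-att-p3` g34 of the NEIGHBOURING cell `bsd-f1-sign2` (route `AlignedTransportAtTwo`) as a
`--supports` helper for the `ByReductionTypeAtTwo` ledger (stmt-BirchSwinnertonDyer-19577), because this seat's new Literature theorems
(`classicalMuVanishes_of_finrank_eq_two`, `classicalMu_of_sq_eq_of_isTotallyComplex`) remove the named fact `ferreroWashington1979_classicalMuVanishes`
(`hFW`) from `AddKatoTwo.conjA_two_of_isAbelianGalois_divisionField_two` on the part of its domain where `ℚ(E[2])` has degree `≤ 2`. THEOREMS ONLY;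
nothing closed; Lim 2017 Thm. 3.5 at `p = 2` (`hLim2`) remains the displayed input; BSD is NOT proved.

* ★ `classicalMuVanishes_divisionField_two_sup_adjoin_I_of_finrank_le_two` — `W/ℚ` elliptic with `[ℚ(W[2]) : ℚ] ≤ 2`, `i² = −1`, `√2 ∉ ℚ(W[2]) ⊔ ℚ⟮i⟯`:
  **`μ₂ = 0` for every cyclotomic `ℤ₂`-extension of `ℚ(W[2]) ⊔ ℚ⟮i⟯`** — if `ℚ(W[2]) ≤ ℚ⟮i⟯` the carrier is the quadratic field `ℚ(i)`
  (`classicalMuVanishes_of_finrank_eq_two`); otherwise `ℚ(W[2]) = ℚ(θ)`, `θ² = c ∈ ℚ`, and the carrier is `ℚ⟮i⟯(θ)`, quadratic over the totally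
  complex `ℚ(i)` (`classicalMu_of_sq_eq_of_isTotallyComplex`, Iwasawa 1973 Thm. 3 verbatim; no unit signatures).
* ★★ `conjA_two_of_finrank_divisionField_two_le_two` — granted ONLY `hLim2`: **statement (A) at `(E, 2)`** (a fine Selmer dual datum finitely generated
  over `ℤ₂` for every cyclotomic datum) for every such `E` — `AddKatoTwo.conjA_two_of_isAbelianGalois_divisionField_two` with `hFW` DISCHARGED on the
  sub-domain `[ℚ(E[2]) : ℚ] ≤ 2` (the cyclic-cubic `ℚ(E[2])` case still needs Ferrero–Washington).

References: [Lim2017FineSelmer] §3 Thm. 3.5, Lemma 3.2; [Iwasawa1973MuInvariants] Thm. 3, §4; [CoatesSujatha2005] statement (A), Thm. 3.4; [Washington1997] §13.3.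
-/

set_option autoImplicit false
set_option linter.dupNamespace false

noncomputable section

open scoped Classical IntermediateField NumberField

namespace Summit.BirchSwinnertonDyer.BirchSwinnertonDyer.Theorems.AddKatoTwoRationalTwoTorsion

open WeierstrassCurve Field Polynomial IntermediateField NumberField Literature.NumberTheory.EllipticCurves
  Literature.NumberTheory.EllipticCurves.ZpExtension Literature.NumberTheory.GaloisRepresentations
  Literature.NumberTheory.IwasawaTheory Literature.NumberTheory.NumberFields Literature.NumberTheory.QuadraticFields
  Summit.BirchSwinnertonDyer.BirchSwinnertonDyer.Theorems.AddKatoTwo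

variable (W : WeierstrassCurve ℚ) [W.IsElliptic]

/-- ★ **`μ₂(ℚ(W[2], √−1)^{cyc}) = 0` when `[ℚ(W[2]) : ℚ] ≤ 2` and `√2 ∉ ℚ(W[2], √−1)`** (every cyclotomic `ℤ₂`-extension; growth form). If `ℚ(W[2]) ≤ ℚ⟮i⟯`
the carrier is the quadratic field `ℚ⟮i⟯`; otherwise `ℚ(W[2]) = ℚ(θ)` with `θ² = c ∈ ℚ`, `θ ∉ ℚ⟮i⟯`, and `ℚ(W[2]) ⊔ ℚ⟮i⟯ = ℚ⟮i⟯(θ)` is quadratic over the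
totally complex `ℚ⟮i⟯` (Iwasawa 1973 Thm. 3, kernel form; `μ₂(ℚ(i)) = 0` by genus theory). [cite: Iwasawa1973MuInvariants, Thm. 3 and §4]
[cite: Washington1997, §13.3 Prop. 13.23] -/
theorem classicalMuVanishes_divisionField_two_sup_adjoin_I_of_finrank_le_two
    (hdeg : Module.finrank ℚ ↥(W.divisionField 2) ≤ 2) {i : AlgebraicClosure ℚ} (hi : i ^ 2 = -1)
    (h2 : ∀ z : ↥(W.divisionField 2 ⊔ IntermediateField.adjoin ℚ ({i} : Set (AlgebraicClosure ℚ))), z ^ 2 ≠ 2) :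
    ∀ κL : ZpExtension ↥(W.divisionField 2 ⊔ IntermediateField.adjoin ℚ ({i} : Set (AlgebraicClosure ℚ))) 2,
      κL.IsCyclotomic → ClassicalMuVanishes κL := by
  haveI : Fact (Nat.Prime 2) := ⟨Nat.prime_two⟩
  set Qi : IntermediateField ℚ (AlgebraicClosure ℚ) := IntermediateField.adjoin ℚ ({i} : Set (AlgebraicClosure ℚ)) with hQi
  set T : IntermediateField ℚ (AlgebraicClosure ℚ) := W.divisionField 2 with hTdef
  set M : IntermediateField ℚ (AlgebraicClosure ℚ) := T ⊔ Qi with hMdef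
  have hint : IsIntegral ℚ i := by
    refine ⟨X ^ 2 + 1, monic_X_pow_add_C _ two_ne_zero, ?_⟩
    simp [hi]
  haveI : FiniteDimensional ℚ ↥Qi := IntermediateField.adjoin.finiteDimensional hint
  haveI hNFQi : NumberField ↥Qi := NumberField.of_module_finite ℚ _
  haveI : NumberField ↥T := NumberField.mk
  haveI : FiniteDimensional ℚ ↥M := IntermediateField.finiteDimensional_sup T Qi
  haveI hNF : NumberField ↥M := NumberField.of_module_finite ℚ _
  have hiQi : i ∈ Qi := IntermediateField.mem_adjoin_simple_self ℚ i
  have hiM : i ∈ M := (le_sup_right : Qi ≤ M) hiQi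
  -- `ℚ⟮i⟯` is an (imaginary) quadratic field
  have hiQ : i ∉ Set.range (algebraMap ℚ (AlgebraicClosure ℚ)) := by
    rintro ⟨q, hq⟩
    have h : ((q * q : ℚ) : AlgebraicClosure ℚ) = -1 := by rw [← hi, ← hq, eq_ratCast]; push_cast; ring
    have h' : q * q = -1 := by exact_mod_cast h
    nlinarith [mul_self_nonneg q]
  have hQi2 : Module.finrank ℚ ↥Qi = 2 :=
    finrank_adjoin_simple_eq_two_of_sq_eq (a := (-1 : ℚ)) (by rw [hi, map_neg, map_one]) hiQ
  have hμQi : ∀ κ : ZpExtension ↥Qi 2, κ.IsCyclotomic → ClassicalMuVanishes κ :=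
    fun κ hκ ↦ classicalMuVanishes_of_finrank_eq_two ↥Qi hQi2 κ hκ
  by_cases hTQi : T ≤ Qi
  · -- the carrier IS `ℚ⟮i⟯`
    have hMQi : M = Qi := sup_eq_right.mpr hTQi
    have hM2 : Module.finrank ℚ ↥M = 2 := by rw [(IntermediateField.equivOfEq hMQi).toLinearEquiv.finrank_eq, hQi2]
    intro κL hκL
    exact classicalMuVanishes_of_finrank_eq_two ↥M hM2 κL hκL
  -- `T` is quadratic, generated by `θ` with `θ² = c ∈ ℚ`, and `θ ∉ ℚ⟮i⟯`
  have hT2 : Module.finrank ℚ ↥T = 2 := by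
    have hpos : 0 < Module.finrank ℚ ↥T := Module.finrank_pos
    rcases Nat.lt_or_ge (Module.finrank ℚ ↥T) 2 with h | h
    · exfalso
      have h1 : Module.finrank ℚ ↥T = 1 := by omega
      have hbot : T = ⊥ := IntermediateField.finrank_eq_one_iff.mp h1
      exact hTQi (hbot ▸ bot_le)
    · omega
  obtain ⟨θ, c, hθQ, hθc⟩ := Quadratic.exists_sq_eq_algebraMap (F := ℚ) (K := ↥T) hT2
  have hθT : (θ : AlgebraicClosure ℚ) ∈ T := θ.2
  have hθsq : ((θ : AlgebraicClosure ℚ)) ^ 2 = ((c : ℚ) : AlgebraicClosure ℚ) := by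
    have := congrArg (fun t : ↥T ↦ (t : AlgebraicClosure ℚ)) hθc
    simpa [eq_ratCast] using this
  have hθQ' : (θ : AlgebraicClosure ℚ) ∉ Set.range (algebraMap ℚ (AlgebraicClosure ℚ)) := by
    rintro ⟨q, hq⟩
    exact hθQ ⟨q, Subtype.ext (by rw [← hq]; rfl)⟩
  -- `T = ℚ⟮θ⟯`
  have hTθ : T = ℚ⟮(θ : AlgebraicClosure ℚ)⟯ := by
    have hle : ℚ⟮(θ : AlgebraicClosure ℚ)⟯ ≤ T := adjoin_simple_le_iff.mpr hθT
    have hθint : IsIntegral ℚ (θ : AlgebraicClosure ℚ) := ((AlgebraicClosure.isAlgebraic ℚ).isAlgebraic _).isIntegral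
    haveI : FiniteDimensional ℚ ↥ℚ⟮(θ : AlgebraicClosure ℚ)⟯ := IntermediateField.adjoin.finiteDimensional hθint
    have h2' : Module.finrank ℚ ↥ℚ⟮(θ : AlgebraicClosure ℚ)⟯ = 2 :=
      finrank_adjoin_simple_eq_two_of_sq_eq (a := c) (by rw [hθsq, eq_ratCast]) hθQ'
    exact (IntermediateField.eq_of_le_of_finrank_eq hle (by rw [h2', hT2])).symm
  have hθQi : (θ : AlgebraicClosure ℚ) ∉ Qi := fun h ↦ hTQi (hTθ ▸ adjoin_simple_le_iff.mpr h)
  -- both fields totally complex; the inclusion `ℚ⟮i⟯ ≤ M`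
  haveI : IsTotallyComplex ↥Qi := ⟨FineSelmerUpstairs.isComplex_of_mem_sq_eq_neg_one i hi _ hiQi⟩
  have hQiM : Qi ≤ M := le_sup_right
  letI : Algebra ↥Qi ↥M := (IntermediateField.inclusion hQiM).toRingHom.toAlgebra
  haveI : IsScalarTower ℚ ↥Qi ↥M := IsScalarTower.of_algebraMap_eq fun _ ↦ rfl
  -- the integral generator `x = den(c)·θ`, `x² = num(c)·den(c)`
  set N : ℤ := c.num * c.den with hNdef
  have hc0 : c ≠ 0 := by
    intro h0
    apply hθQ ⟨0, ?_⟩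
    have : θ ^ 2 = 0 := by rw [hθc, h0, map_zero]
    exact (pow_eq_zero_iff two_ne_zero).mp this |>.symm ▸ (map_zero _)
  have hN0 : N ≠ 0 := mul_ne_zero (Rat.num_ne_zero.mpr hc0) (by exact_mod_cast c.den_nz)
  have hθM : (θ : AlgebraicClosure ℚ) ∈ M := (le_sup_left : T ≤ M) hθT
  have hxsq : ((c.den : AlgebraicClosure ℚ) * θ) ^ 2 = ((N : ℚ) : AlgebraicClosure ℚ) := by
    have h := Rat.mul_den_eq_num c
    rw [mul_pow, hθsq, hNdef]
    push_cast
    calc (c.den : AlgebraicClosure ℚ) ^ 2 * (c : AlgebraicClosure ℚ)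
        = (c.den : AlgebraicClosure ℚ) * ((c : AlgebraicClosure ℚ) * (c.den : AlgebraicClosure ℚ)) := by ring
      _ = (c.den : AlgebraicClosure ℚ) * (c.num : AlgebraicClosure ℚ) := by
          rw [show (c : AlgebraicClosure ℚ) * (c.den : AlgebraicClosure ℚ) = (c.num : AlgebraicClosure ℚ) by exact_mod_cast h]
      _ = (c.num : AlgebraicClosure ℚ) * (c.den : AlgebraicClosure ℚ) := by ring
  have hxint : IsIntegral ℤ ((c.den : AlgebraicClosure ℚ) * θ) := by
    refine ⟨X ^ 2 - C N, monic_X_pow_sub_C N two_ne_zero, ?_⟩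
    simp only [eval₂_sub, eval₂_X_pow, eval₂_C, hxsq]
    simp
  have hxM : (c.den : AlgebraicClosure ℚ) * θ ∈ M := mul_mem (IntermediateField.natCast_mem M c.den) hθM
  set x : 𝓞 ↥M := ⟨⟨(c.den : AlgebraicClosure ℚ) * θ, hxM⟩,
    (isIntegral_algHom_iff (IsScalarTower.toAlgHom ℤ ↥M (AlgebraicClosure ℚ)) Subtype.val_injective).mp hxint⟩ with hxdef
  have hm : ((N : 𝓞 ↥Qi)) ≠ 0 := fun h0 ↦ hN0 (Int.cast_eq_zero.mp h0)
  have hx : x ^ 2 = algebraMap (𝓞 ↥Qi) (𝓞 ↥M) (N : 𝓞 ↥Qi) := by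
    apply RingOfIntegers.ext
    apply Subtype.ext
    change ((c.den : AlgebraicClosure ℚ) * θ) ^ 2 = (((algebraMap (𝓞 ↥Qi) (𝓞 ↥M) (N : 𝓞 ↥Qi) : 𝓞 ↥M) : ↥M) : AlgebraicClosure ℚ)
    rw [hxsq, map_intCast]
    push_cast
    rfl
  -- `M = ℚ⟮i⟯[x]`
  have hgen : Algebra.adjoin ↥Qi {((x : 𝓞 ↥M) : ↥M)} = ⊤ := by
    set A : Subalgebra ↥Qi ↥M := Algebra.adjoin ↥Qi {((x : 𝓞 ↥M) : ↥M)} with hA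
    let S : Subalgebra ℚ (AlgebraicClosure ℚ) :=
      { carrier := {w | ∃ hw : w ∈ M, (⟨w, hw⟩ : ↥M) ∈ A}
        mul_mem' := by
          rintro a b ⟨ha, ha'⟩ ⟨hb, hb'⟩
          exact ⟨mul_mem ha hb, by
            have e : (⟨a * b, mul_mem ha hb⟩ : ↥M) = ⟨a, ha⟩ * ⟨b, hb⟩ := rfl
            rw [e]; exact A.mul_mem ha' hb'⟩
        one_mem' := ⟨one_mem _, by
          have e : (⟨1, one_mem _⟩ : ↥M) = 1 := rfl
          rw [e]; exact A.one_mem⟩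
        add_mem' := by
          rintro a b ⟨ha, ha'⟩ ⟨hb, hb'⟩
          exact ⟨add_mem ha hb, by
            have e : (⟨a + b, add_mem ha hb⟩ : ↥M) = ⟨a, ha⟩ + ⟨b, hb⟩ := rfl
            rw [e]; exact A.add_mem ha' hb'⟩
        zero_mem' := ⟨zero_mem _, by
          have e : (⟨0, zero_mem _⟩ : ↥M) = 0 := rfl
          rw [e]; exact A.zero_mem⟩
        algebraMap_mem' := fun t ↦ ⟨IntermediateField.algebraMap_mem M t, A.algebraMap_mem (algebraMap ℚ ↥Qi t)⟩ }
    have hQiS : ∀ w (hw : w ∈ Qi), w ∈ S := fun w hw ↦ ⟨hQiM hw, by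
      have e : (⟨w, hQiM hw⟩ : ↥M) = algebraMap ↥Qi ↥M ⟨w, hw⟩ := rfl
      rw [e]; exact A.algebraMap_mem _⟩
    have hxS : (c.den : AlgebraicClosure ℚ) * θ ∈ S := ⟨hxM, Algebra.subset_adjoin (Set.mem_singleton _)⟩
    have hθS : (θ : AlgebraicClosure ℚ) ∈ S := by
      have hd0 : ((c.den : ℚ) : AlgebraicClosure ℚ) ≠ 0 := by exact_mod_cast c.den_nz
      have e : (θ : AlgebraicClosure ℚ) = ((c.den : ℚ)⁻¹) • ((c.den : AlgebraicClosure ℚ) * θ) := by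
        rw [Algebra.smul_def, map_inv₀]
        push_cast
        field_simp
      rw [e]
      exact S.smul_mem hxS _
    have hθint : IsIntegral ℚ (θ : AlgebraicClosure ℚ) := ((AlgebraicClosure.isAlgebraic ℚ).isAlgebraic _).isIntegral
    have hTS : T.toSubalgebra ≤ S := by
      rw [hTθ, IntermediateField.adjoin_simple_toSubalgebra_of_isAlgebraic hθint.isAlgebraic]
      exact Algebra.adjoin_le (Set.singleton_subset_iff.mpr hθS)
    have hQiS' : Qi.toSubalgebra ≤ S := fun w hw ↦ hQiS w hw
    have hMS : M.toSubalgebra ≤ S := by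
      haveI : Algebra.IsAlgebraic ℚ ↥Qi := Algebra.IsAlgebraic.of_finite ℚ ↥Qi
      rw [hMdef, IntermediateField.sup_toSubalgebra_of_isAlgebraic_right]
      exact sup_le hTS hQiS'
    rw [eq_top_iff]
    rintro ⟨w, hw⟩ -
    obtain ⟨hw', h⟩ := hMS hw
    exact h
  -- `[M : ℚ⟮i⟯] = 2`
  have hdegQiM : Module.finrank ↥Qi ↥M = 2 := by
    haveI : FiniteDimensional ↥Qi ↥M := Module.Finite.of_restrictScalars_finite ℚ ↥Qi ↥M
    set y : ↥M := ((x : 𝓞 ↥M) : ↥M) with hy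
    have hyint : IsIntegral ↥Qi y := IsIntegral.of_finite _ y
    have htop : (↥Qi)⟮y⟯ = ⊤ := by
      apply IntermediateField.toSubalgebra_injective
      rw [IntermediateField.adjoin_simple_toSubalgebra_of_isAlgebraic hyint.isAlgebraic, hgen, IntermediateField.top_toSubalgebra]
    have hfin : Module.finrank ↥Qi ↥M = (minpoly ↥Qi y).natDegree := by
      rw [← IntermediateField.adjoin.finrank hyint, htop, IntermediateField.finrank_top']
    have hy2 : y ^ 2 = algebraMap ↥Qi ↥M (N : ↥Qi) := by
      apply Subtype.ext
      change ((c.den : AlgebraicClosure ℚ) * θ) ^ 2 = ((algebraMap ↥Qi ↥M (N : ↥Qi) : ↥M) : AlgebraicClosure ℚ)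
      rw [hxsq, map_intCast]
      push_cast
      rfl
    have hle2 : (minpoly ↥Qi y).natDegree ≤ 2 := by
      have hp : (X ^ 2 - C (N : ↥Qi) : (↥Qi)[X]) ≠ 0 := X_pow_sub_C_ne_zero two_pos _
      have hroot : aeval y (X ^ 2 - C (N : ↥Qi) : (↥Qi)[X]) = 0 := by simp [hy2]
      have h := natDegree_le_natDegree (minpoly.degree_le_of_ne_zero ↥Qi y hp hroot)
      rwa [natDegree_X_pow_sub_C] at h
    have hne : Module.finrank ↥Qi ↥M ≠ 1 := by
      intro h1
      have hbt : (⊥ : IntermediateField ↥Qi ↥M) = ⊤ := IntermediateField.bot_eq_top_iff_finrank_eq_one.mpr h1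
      have hyb : y ∈ (⊥ : IntermediateField ↥Qi ↥M) := by rw [hbt]; trivial
      obtain ⟨t, ht'⟩ := IntermediateField.mem_bot.mp hyb
      apply hθQi
      have htv : (t : AlgebraicClosure ℚ) = (c.den : AlgebraicClosure ℚ) * θ := by
        have h := congrArg (fun z : ↥M ↦ (z : AlgebraicClosure ℚ)) ht'
        exact h
      have hd0 : (c.den : AlgebraicClosure ℚ) ≠ 0 := by exact_mod_cast c.den_nz
      have e : (θ : AlgebraicClosure ℚ) = (t : AlgebraicClosure ℚ) * (c.den : AlgebraicClosure ℚ)⁻¹ := by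
        rw [htv]; field_simp
      rw [e]
      exact mul_mem t.2 (inv_mem (IntermediateField.natCast_mem Qi c.den))
    have hpos : 0 < (minpoly ↥Qi y).natDegree := minpoly.natDegree_pos hyint
    omega
  -- the ascent over the totally complex base `ℚ⟮i⟯`
  exact classicalMu_of_sq_eq_of_isTotallyComplex ↥Qi ↥M hdegQiM hm hx hgen h2 hμQi

/-- ★★ **Statement (A) at `(E, 2)` for `[ℚ(E[2]) : ℚ] ≤ 2`, granted ONLY Lim 2017 Thm. 3.5 at `p = 2`** (`hLim2`; NO Ferrero–Washington): for every elliptic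
`W/ℚ` whose `2`-division field has degree `≤ 2` (a rational `2`-torsion point) and with `√2 ∉ ℚ(W[2], √−1)` for some square root `i` of `−1` in `ℚ̄` (i.e.
`ℚ(W[2]) ∉ {ℚ(√2), ℚ(√−2)}`), every cyclotomic datum carries a fine Selmer dual datum finitely generated over `ℤ₂` — `AddKatoTwo.conjA_two_of_abelianSubfield`'s
carrier `ℚ(W[2]) ⊔ ℚ⟮i⟯ ≤ ℚ(W[4])` (2-power index) with its `μ₂ = 0` input PROVED by the previous theorem. [cite: Lim2017FineSelmer, §3 Thm. 3.5 and Lemma 3.2]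
[cite: CoatesSujatha2005, statement (A) and Thm. 3.4] [cite: Iwasawa1973MuInvariants, Thm. 3] -/
theorem conjA_two_of_finrank_divisionField_two_le_two
    (hLim2 : Lim2017.thm35_at_two_fineSelmerDual_moduleFinite_of_classicalMuVanishes_of_le_divisionField_four)
    (hdeg : Module.finrank ℚ ↥(W.divisionField 2) ≤ 2) {i : AlgebraicClosure ℚ} (hi : i ^ 2 = -1)
    (h2 : ∀ z : ↥(W.divisionField 2 ⊔ IntermediateField.adjoin ℚ ({i} : Set (AlgebraicClosure ℚ))), z ^ 2 ≠ 2) :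
    ∀ (κ : ZpExtension ℚ 2), κ.IsCyclotomic →
      ∃ (γ : Field.absoluteGaloisGroup ℚ) (D : W.FineSelmerDualData κ γ),
        Module.Finite ℤ_[2] (RestrictScalars ℤ_[2] (IwasawaAlgebra 2) D.X) :=
  hLim2 W _ (divisionField_two_sup_adjoin_le_divisionField_four W hi)
    (exists_finrank_divisionField_four_eq_pow_mul_divisionField_two_sup_adjoin W hi)
    (classicalMuVanishes_divisionField_two_sup_adjoin_I_of_finrank_le_two W hdeg hi h2)

end Summit.BirchSwinnertonDyer.BirchSwinnertonDyer.Theorems.AddKatoTwoRationalTwoTorsion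

end
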